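import Summits.QuantumFields.BalabanUV.T4Continuum.Spine.NE5.TwoRunTorusRate
import Summits.QuantumFields.BalabanUV.T4Continuum.Spine.NE5.TwoRunTorusPrimitiveParam

/-!
# Spine/NE5/TwoRunTorusPrimitivePencil — NE5 AT ONE PAIRED SCALE ON THE PAPERS' PERIODIC CARRIER FROM PER-TERM PRIMITIVE
# PENCILS, ONE THEOREM (cell `pub-balaban-gaps`, seat `ne5` gen 8)

WHY.  T14 `TwoRunTorusRate.norm_E_sub_le_torus` derives NE5's inequality at one paired scale on the two-scale torus model
from a pencil of (2.14)-TERM families `θ ↦ P Z t φ θ` (holomorphic on `ball 0 ρ`, (2.26) uniform: `hPhol`, `h226`); T21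
`TwoRunTorusPrimitiveParam.hol_and_h226_torus_of_primitives_param` supplies `hPhol ∧ h226` for ONE term from PRIMITIVE data
along any parameter.  THIS FILE is the composition at the family level (standing offer (s8-a) of `HOME/ne/NE5.md` §14):
`norm_E_sub_le_torus_of_primitives` — the (2.14)-terms of the model READ FROM PER-TERM PRIMITIVE PENCILS
`θ ↦ (A Z t φ θ, G Z t φ θ, 𝐕 Z t φ θ)` (bond types `Λ Z t`, `C₀ Z t` per term), with T21's hypotheses for every term and
configuration on the space, Lemma 3's and (2.39)–(2.41)'s numbers verbatim as in T14, the two runs' activities = the sums of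
the members at `θ = 0` and `θ = 1`, and (2.13) per run ⇒ `‖E^B(X)(φ) − E^A(X)(φ)‖ ≤ (2∕ρ)·A₂C₃ε₁·e^{−(1−10δ)½Lκd_{k+1}(X)}`
on `sp2 X`.  Read per scale `j` with `ρ = s∕r_j` this is the input of T16 `TwoRunTorusNE5.ne5_of_torus_rates(_all_scales)`,
i.e. `T4OutputRate.NE5` BY NAME.  So on the periodic carrier NE5 is ONE theorem whose data are NODE O's per-term primitive
kernel families along the two-run pencil (for the affine pencil of two runs' kernels the operator hypotheses follow from
run A's letters + the primitive-level W1: `Spine/NE5/TwoRunPrimitivePencil`), the potentials with (2.20), the common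
characteristic functions ((x9): defined on the Gaussian variable, [II] (2.3)∕(2.22)), the constants, and the numerics.

HONEST FRAMING.  Pure composition of T14 and T21 over LANDED shapes; every family, region, letter and number is a
HYPOTHESIS; nothing of Bałaban's is constructed or asserted; NE5 NOT PRINTED ∕ NOT PROVED; leaves on Bałaban's carriers
of record 0∕12; (D4) 0∕1; spine 0∕9.  Rung (B)+1 on a FIXED finite T⁴ — NOT continuum, NOT infinite volume, NOT mass
gap, NOT Clay.  HONEST DEPENDENCY: continuum YM on T⁴ ⇐ BetaPertH ∧ nine spine estimates; BetaPertH ⇐ (D1) ∧ (D4) ∧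
CAP+tail.  0 sorry, 0 `def`.

Sources: [II] = T. Bałaban, CMP **116** (1988) [Balaban1988RG2Cluster] (2.13)–(2.15) pp. 14–15, (2.16)–(2.26) pp. 16–17,
Lemma 3 (2.38) p. 20, (2.41) p. 21; [I] = CMP **109** (1987) [Balaban1987RG1] (1.18) p. 263; C. King, CMP **102** (1986)
[King1986] Thm 3.4 p. 656, p. 665.  Nothing here is a claim about the Yang–Mills mass gap.
-/

noncomputable section

namespace Summit.QuantumFields.BalabanUV.T4Continuum.Spine.NE5.TwoRunTorusPrimitivePencil

open Matrix Metric Set Finset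
open Literature.MathematicalPhysics.QuantumFieldTheory.Balaban1983to89
open Literature.MathematicalPhysics.QuantumFieldTheory.Balaban1983to89.TreeLengthTorus (TPt TDom tsys)
open Literature.MathematicalPhysics.QuantumFieldTheory.Balaban1983to89.TreeLengthTorusGeometry (TTouch)
open Literature.MathematicalPhysics.QuantumFieldTheory.Balaban1983to89.TreeLengthTorusTransfer (tclosure)
open Literature.MathematicalPhysics.QuantumFieldTheory.Balaban1983to89.B13Lemma3TorusData (TBond)
open Literature.MathematicalPhysics.QuantumFieldTheory.Balaban1983to89.B13Lemma3Torus (TwoTorusStep)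
open Literature.MathematicalPhysics.QuantumFieldTheory.Balaban1983to89.B13Lemma3TorusTerms (terms weight Z0)
open Literature.MathematicalPhysics.QuantumFieldTheory.Balaban1983to89.B12TreeDecay (kappa₀ K₀)
open Literature.MathematicalPhysics.QuantumFieldTheory.Balaban1983to89.B13Resummation (locE)
open Literature.MathematicalPhysics.QuantumFieldTheory.Balaban1983to89.B13Term214 (core214 F214 term214)
open Literature.MathematicalPhysics.QuantumFieldTheory.Balaban1983to89.B13Bound143 (invTau)
open Literature.MathematicalPhysics.QuantumFieldTheory.Balaban1983to89.B5TorusCover (UT)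
open Literature.MathematicalPhysics.QuantumFieldTheory.Balaban1983to89.B9Thm37GlueTorus (tdist1)
open Summit.QuantumFields.BalabanUV.T4Continuum.Spine.NE5.TwoRunTorusRate (norm_E_sub_le_torus)
open Summit.QuantumFields.BalabanUV.T4Continuum.Spine.NE5.TwoRunTorusPrimitiveParam
  (hol_and_h226_torus_of_primitives_param)

variable {L N' : ℕ} [NeZero L] [NeZero N'] {M : ℕ} [NeZero M]
variable {ν : ℕ} {Nf : Fin ν → ℕ} [∀ i, NeZero (Nf i)]

open Classical in
/-- **NE5 AT ONE PAIRED SCALE ON THE TWO-SCALE TORUS MODEL, FROM PER-TERM PRIMITIVE PENCILS.**  Data per term `(Z, t)`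
(`t ∈ terms L M Z`) and configuration `φ ∈ sp2 Z`: bond types `Λ Z t`, `C₀ Z t` located on the site torus `UT Nf` (`≤ m`
per site), the pencil `θ ↦ (A Z t φ θ σ, G Z t φ θ σ, 𝐕 Z t φ θ Y)` on `ball 0 ρ` (`ρ > 1`) with the hypotheses of
`TwoRunTorusPrimitiveParam.hol_and_h226_torus_of_primitives_param` (letters on the open σ-polydisc and per-domain
τ-regions, entrywise holomorphy in σ and θ, symmetry, `Re ≻ 0`, (2.20), (2.22), smallness, constant matching — ONE
package for all terms), the reference real operators `C Z t φ`, `Γ₀ Z t φ`, the common characteristic functions and `𝐃`;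
the two runs' activities `H^A(Z) = Σ_t P(Z,t,φ,0)`, `H^B(Z) = Σ_t P(Z,t,φ,1)` with
`P Z t φ θ := term214 r (lZ Z t) (lD t) (core214 (A Z t φ θ) (Γ Z t φ θ) (F214 |P(t)| χ χᶜ 𝐃 (𝐕 Z t φ θ))) 0 0`, the outputs by
(2.13) per run, the space restriction p. 15, and Lemma 3's ∕ (2.39)–(2.41)'s numbers verbatim as in
`TwoRunTorusRate.norm_E_sub_le_torus`.  Conclusion: `‖E^B(X)(φ) − E^A(X)(φ)‖ ≤ (2∕ρ)·A₂C₃ε₁·e^{−(1−10δ)½Lκd_{k+1}(X)}` on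
`sp2 X` — NE5's printed-shape inequality at one paired scale (`ρ = s∕r_j`; T16 reads it as `T4OutputRate.NE5`).
[cite: Balaban1988RG2Cluster, (2.13) p.14, (2.14)–(2.26) pp.15–17, (2.38) p.20, (2.41) p.21; Balaban1987RG1, (1.18) p.263; King1986, Thm 3.4 p.656, p.665] -/
theorem norm_E_sub_le_torus_of_primitives (c : B13.Consts) (hL : 8 ≤ c.L) (hLc : c.L = L) (hκ₁ : 1 ≤ c.κ₁)
    (hα₆' : c.α₆ ≠ 0) (W : TwoTorusStep 4 L N') {ρ : ℝ} (hρ : 1 < ρ)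
    -- regions, radii, contour radius, parameter lists (common to the family)
    (hpos : ∀ Y : TDom 4 (L * N'), 0 < invTau c ((tsys 4 (L * N')).dj Y))
    (hhalf : ∀ Y : TDom 4 (L * N'), invTau c ((tsys 4 (L * N')).dj Y) ≤ 1 / 2)
    {Uσ : Set ℂ} {Uτ : TDom 4 (L * N') → Set ℂ} (hUσ : IsOpen Uσ) (hUτ : ∀ Y, IsOpen (Uτ Y))
    (hUexp : closedBall (0 : ℂ) (Real.exp c.κ₁) ⊆ Uσ)
    (hUtau : ∀ Y : TDom 4 (L * N'), closedBall (0 : ℂ) ((invTau c ((tsys 4 (L * N')).dj Y))⁻¹) ⊆ Uτ Y)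
    {r : ℝ} (hr : 0 < r) (hr' : r ≤ Real.exp c.κ₁ - 1)
    (hsubτ : ∀ Y, ∀ s ∈ Set.uIcc (0 : ℝ) 1, closedBall (s : ℂ) r ⊆ Uτ Y)
    (lZ : TDom 4 N' → Finset (TDom 4 (L * N')) × Finset (TBond 4 M (L * N')) → List (TPt 4 N'))
    (hlZ : ∀ Z t, (lZ Z t).Nodup ∧ (lZ Z t).toFinset = Z.1 \ tclosure L N' (Z0 M t))
    (lD : Finset (TDom 4 (L * N')) × Finset (TBond 4 M (L * N')) → List (TDom 4 (L * N')))
    (hlD : ∀ t, (lD t).Nodup ∧ (lD t).toFinset = t.1)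
    -- per-term bond types and the primitive pencils
    (Λ C₀ : TDom 4 N' → Finset (TDom 4 (L * N')) × Finset (TBond 4 M (L * N')) → Type)
    [∀ Z t, Fintype (Λ Z t)] [∀ Z t, DecidableEq (Λ Z t)] [∀ Z t, Fintype (C₀ Z t)] [∀ Z t, DecidableEq (C₀ Z t)]
    (A : (Z : TDom 4 N') → (t : Finset (TDom 4 (L * N')) × Finset (TBond 4 M (L * N'))) → W.Φ → ℂ →
      (TPt 4 N' → ℂ) → Matrix (Λ Z t) (Λ Z t) ℂ)
    (Γ : (Z : TDom 4 N') → (t : Finset (TDom 4 (L * N')) × Finset (TBond 4 M (L * N'))) → W.Φ → ℂ →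
      (TPt 4 N' → ℂ) → (Λ Z t ⊕ C₀ Z t → ℝ) → (Λ Z t → ℂ))
    (G : (Z : TDom 4 N') → (t : Finset (TDom 4 (L * N')) × Finset (TBond 4 M (L * N'))) → W.Φ → ℂ →
      (TPt 4 N' → ℂ) → Matrix (Λ Z t) (Λ Z t ⊕ C₀ Z t) ℂ)
    (χY₀ χcP : (Z : TDom 4 N') → (t : Finset (TDom 4 (L * N')) × Finset (TBond 4 M (L * N'))) → W.Φ →
      (Λ Z t → ℝ) → ℝ)
    (hχ0 : ∀ Z t φ Bf, 0 ≤ χY₀ Z t φ Bf) (hχc0 : ∀ Z t φ Bf, 0 ≤ χcP Z t φ Bf)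
    (Dfam : TDom 4 N' → Finset (TDom 4 (L * N')) × Finset (TBond 4 M (L * N')) → Finset (TDom 4 (L * N')))
    (Vk : (Z : TDom 4 N') → (t : Finset (TDom 4 (L * N')) × Finset (TBond 4 M (L * N'))) → W.Φ → ℂ →
      TDom 4 (L * N') → (Λ Z t → ℝ) → ℂ)
    (C : (Z : TDom 4 N') → (t : Finset (TDom 4 (L * N')) × Finset (TBond 4 M (L * N'))) → W.Φ →
      Matrix (Λ Z t) (Λ Z t) ℝ) (hC : ∀ Z t φ, (C Z t φ).PosDef)
    (Γ₀ : (Z : TDom 4 N') → (t : Finset (TDom 4 (L * N')) × Finset (TBond 4 M (L * N'))) → W.Φ →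
      Matrix (Λ Z t) (Λ Z t ⊕ C₀ Z t) ℝ)
    -- regularity along the pencil
    (hAhol : ∀ Z, ∀ t ∈ terms L M Z, ∀ φ, φ ∈ W.sp2 Z → ∀ b ∈ ball (0 : ℂ) ρ, ∀ i j,
      DifferentiableOn ℂ (fun σ => A Z t φ b σ i j) {σ | ∀ j, σ j ∈ Uσ})
    (hGhol : ∀ Z, ∀ t ∈ terms L M Z, ∀ φ, φ ∈ W.sp2 Z → ∀ b ∈ ball (0 : ℂ) ρ, ∀ i j,
      DifferentiableOn ℂ (fun σ => G Z t φ b σ i j) {σ | ∀ j, σ j ∈ Uσ})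
    (hAholb : ∀ Z, ∀ t ∈ terms L M Z, ∀ φ, φ ∈ W.sp2 Z → ∀ σ : TPt 4 N' → ℂ, (∀ j, σ j ∈ Uσ) → ∀ i j,
      DifferentiableOn ℂ (fun b => A Z t φ b σ i j) (ball (0 : ℂ) ρ))
    (hGholb : ∀ Z, ∀ t ∈ terms L M Z, ∀ φ, φ ∈ W.sp2 Z → ∀ σ : TPt 4 N' → ℂ, (∀ j, σ j ∈ Uσ) → ∀ i j,
      DifferentiableOn ℂ (fun b => G Z t φ b σ i j) (ball (0 : ℂ) ρ))
    (hVholb : ∀ Z, ∀ t ∈ terms L M Z, ∀ φ, φ ∈ W.sp2 Z → ∀ Y Bf,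
      DifferentiableOn ℂ (fun b => Vk Z t φ b Y Bf) (ball (0 : ℂ) ρ))
    (hχm : ∀ Z t φ, Measurable (χY₀ Z t φ)) (hχcm : ∀ Z t φ, Measurable (χcP Z t φ))
    (hVm : ∀ Z, ∀ t ∈ terms L M Z, ∀ φ, φ ∈ W.sp2 Z → ∀ b ∈ ball (0 : ℂ) ρ, ∀ Y, Measurable (Vk Z t φ b Y))
    (hAs : ∀ Z, ∀ t ∈ terms L M Z, ∀ φ, φ ∈ W.sp2 Z → ∀ b ∈ ball (0 : ℂ) ρ, ∀ σ : TPt 4 N' → ℂ,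
      (∀ j, σ j ∈ Uσ) → (A Z t φ b σ).IsSymm)
    (hA : ∀ Z, ∀ t ∈ terms L M Z, ∀ φ, φ ∈ W.sp2 Z → ∀ b ∈ ball (0 : ℂ) ρ, ∀ σ : TPt 4 N' → ℂ,
      (∀ j, σ j ∈ Uσ) → ((A Z t φ b σ).map Complex.re).PosDef)
    (hlin : ∀ Z, ∀ t ∈ terms L M Z, ∀ φ, φ ∈ W.sp2 Z → ∀ b ∈ ball (0 : ℂ) ρ, ∀ σ : TPt 4 N' → ℂ,
      (∀ j, σ j ∈ Uσ) → ∀ X : Λ Z t ⊕ C₀ Z t → ℝ, Γ Z t φ b σ X = G Z t φ b σ *ᵥ fun j => (X j : ℂ))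
    -- (2.22) and (2.20), uniform along the pencil
    {γ₂ rP a₂₀ w : ℝ}
    (qP : (Z : TDom 4 N') → (t : Finset (TDom 4 (L * N')) × Finset (TBond 4 M (L * N'))) → W.Φ → (Λ Z t → ℝ) → ℝ)
    (h222 : ∀ Z t φ Bf, χY₀ Z t φ Bf * χcP Z t φ Bf ≤
      Real.exp (-(γ₂ / 2 * rP ^ 2 * (t.2.card : ℕ)) + γ₂ / 2 * qP Z t φ Bf))
    (hγ₂ : 0 ≤ γ₂) (hqP : ∀ Z t φ Bf, qP Z t φ Bf ≤ Bf ⬝ᵥ Bf) (ha0 : 0 ≤ a₂₀)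
    (h220U : ∀ Z, ∀ t ∈ terms L M Z, ∀ φ, φ ∈ W.sp2 Z → ∀ b ∈ ball (0 : ℂ) ρ, ∀ τ : TDom 4 (L * N') → ℂ,
      (∀ Y, τ Y ∈ Uτ Y) → ∀ Bf, ∑ Y ∈ Dfam Z t, ‖τ Y‖ * ‖Vk Z t φ b Y Bf‖ ≤ a₂₀ / 2 * (Bf ⬝ᵥ Bf) + w)
    -- located bonds
    (locΛ : (Z : TDom 4 N') → (t : Finset (TDom 4 (L * N')) × Finset (TBond 4 M (L * N'))) → Λ Z t → UT Nf)
    (locN : (Z : TDom 4 N') → (t : Finset (TDom 4 (L * N')) × Finset (TBond 4 M (L * N'))) → Λ Z t ⊕ C₀ Z t → UT Nf)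
    {m : ℕ} (hfibΛ : ∀ Z t, ∀ x : UT Nf, (Finset.univ.filter fun i => locΛ Z t i = x).card ≤ m)
    (hfibN : ∀ Z t, ∀ x : UT Nf, (Finset.univ.filter fun j => locN Z t j = x).card ≤ m)
    -- one package of rates and constants
    {kap kap' kap'' θ θE θΓ θC KG KΓ KCs KC0 : ℝ} (hkap'' : 0 < kap'') (h1 : kap'' < kap') (h2 : kap' < kap)
    (hθE : 0 ≤ θE) (hθΓ : 0 ≤ θΓ) (hθC : 0 ≤ θC) (hKG : 0 ≤ KG) (hKΓ : 0 ≤ KΓ) (hKCs : 0 ≤ KCs) (hKC0 : 0 ≤ KC0)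
    (hθEle : θE ≤ θ) (hθΓle : θΓ ≤ θ)
    (hθR1le : (m * (1 + 2 / (kap - kap')) ^ ν) * (m * (1 + 2 / (kap' - kap'')) ^ ν)
      * (θΓ * KCs * KG + KΓ * θC * KG + KΓ * KC0 * θΓ) ≤ θ)
    -- the located letters along the pencil
    (hG : ∀ Z, ∀ t ∈ terms L M Z, ∀ φ, φ ∈ W.sp2 Z → ∀ b ∈ ball (0 : ℂ) ρ, ∀ σ : TPt 4 N' → ℂ,
      (∀ j, σ j ∈ Uσ) → ∀ i j, ‖G Z t φ b σ i j‖ ≤ KG * Real.exp (-(kap * tdist1 Nf (locΛ Z t i) (locN Z t j))))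
    (hΓ₀ : ∀ Z, ∀ t ∈ terms L M Z, ∀ φ, φ ∈ W.sp2 Z → ∀ i j,
      ‖Γ₀ Z t φ i j‖ ≤ KΓ * Real.exp (-(kap * tdist1 Nf (locΛ Z t i) (locN Z t j))))
    (hCs : ∀ Z, ∀ t ∈ terms L M Z, ∀ φ, φ ∈ W.sp2 Z → ∀ b ∈ ball (0 : ℂ) ρ, ∀ σ : TPt 4 N' → ℂ,
      (∀ j, σ j ∈ Uσ) → ∀ i i',
        ‖(A Z t φ b σ)⁻¹ i i'‖ ≤ KCs * Real.exp (-(kap * tdist1 Nf (locΛ Z t i) (locΛ Z t i'))))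
    (hC216 : ∀ Z, ∀ t ∈ terms L M Z, ∀ φ, φ ∈ W.sp2 Z → ∀ i i',
      ‖C Z t φ i i'‖ ≤ KC0 * Real.exp (-(kap * tdist1 Nf (locΛ Z t i) (locΛ Z t i'))))
    (hdΓ : ∀ Z, ∀ t ∈ terms L M Z, ∀ φ, φ ∈ W.sp2 Z → ∀ b ∈ ball (0 : ℂ) ρ, ∀ σ : TPt 4 N' → ℂ,
      (∀ j, σ j ∈ Uσ) → ∀ i j, ‖(G Z t φ b σ - (Γ₀ Z t φ).map (algebraMap ℝ ℂ)) i j‖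
        ≤ θΓ * Real.exp (-(kap * tdist1 Nf (locΛ Z t i) (locN Z t j))))
    (hdC : ∀ Z, ∀ t ∈ terms L M Z, ∀ φ, φ ∈ W.sp2 Z → ∀ b ∈ ball (0 : ℂ) ρ, ∀ σ : TPt 4 N' → ℂ,
      (∀ j, σ j ∈ Uσ) → ∀ i i', ‖((A Z t φ b σ)⁻¹ - (C Z t φ).map (algebraMap ℝ ℂ)) i i'‖
        ≤ θC * Real.exp (-(kap * tdist1 Nf (locΛ Z t i) (locΛ Z t i'))))
    (hdE : ∀ Z, ∀ t ∈ terms L M Z, ∀ φ, φ ∈ W.sp2 Z → ∀ b ∈ ball (0 : ℂ) ρ, ∀ σ : TPt 4 N' → ℂ,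
      (∀ j, σ j ∈ Uσ) → ∀ i i', ‖(A Z t φ b σ - (C Z t φ)⁻¹.map (algebraMap ℝ ℂ)) i i'‖
        ≤ θE * Real.exp (-(kap * tdist1 Nf (locΛ Z t i) (locΛ Z t i'))))
    (hsmallKθ : KC0 * (m * (1 + 2 / kap) ^ ν) * (θ * (m * (1 + 2 / kap'') ^ ν)) < 1)
    {cE g : ℝ} (hc0 : 0 ≤ cE) (hc : ∀ Z t φ k, (hC Z t φ).1.eigenvalues k ≤ cE)
    (hαc : (2 * (θ * (m * (1 + 2 / kap'') ^ ν)) + (γ₂ + a₂₀)) * cE ≤ 1 / 2) (hg : 0 ≤ g)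
    (hΓq : ∀ Z, ∀ t ∈ terms L M Z, ∀ φ, φ ∈ W.sp2 Z → ∀ X : Λ Z t ⊕ C₀ Z t → ℝ,
      (Γ₀ Z t φ *ᵥ X) ⬝ᵥ (C Z t φ *ᵥ (Γ₀ Z t φ *ᵥ X)) ≤ g * (X ⬝ᵥ X))
    (hsmall : (2 * (θ * (m * (1 + 2 / kap'') ^ ν)) + (γ₂ + a₂₀)) * (1 + 2 * cE * g) ≤ 1 / 2)
    {a a₅ : ℝ} (hPa : a ≤ γ₂ * rP ^ 2)
    (hvol : ∀ Z, ∀ t ∈ terms L M Z,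
      2 * (KC0 * (m * (1 + 2 / kap) ^ ν) * (θ * (m * (1 + 2 / kap'') ^ ν))
              * (1 + (1 - KC0 * (m * (1 + 2 / kap) ^ ν) * (θ * (m * (1 + 2 / kap'') ^ ν)))⁻¹) / 2)
          * (Fintype.card (Λ Z t) : ℝ)
        + w + (2 * (θ * (m * (1 + 2 / kap'') ^ ν)) + (γ₂ + a₂₀)) * cE * (Fintype.card (Λ Z t) : ℝ)
        + (2 * (θ * (m * (1 + 2 / kap'') ^ ν)) + (γ₂ + a₂₀)) * (1 + 2 * cE * g)
          * (Fintype.card (Λ Z t ⊕ C₀ Z t) : ℝ)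
        ≤ a₅ * ((Z.1).card : ℝ))
    -- Lemma 3's and (2.39)–(2.41)'s numbers, verbatim as in `norm_E_sub_le_torus`
    {a₂ a₂' Aabs : ℝ}
    (hα₆ : 0 < c.α₆) (hε₀ : 0 ≤ c.eps2) (hδ : 0 ≤ c.δ) (hδ7 : 0 ≤ 1 - 7 * c.δ) (hκ : 0 ≤ c.κ) (ha : 0 ≤ a)
    (hR15 : c.R15) (hR16 : 18 * ((1 - 4 * c.δ) * c.κ) ≤ a / 20) (hR16' : 4 * c.κ ≤ a / 20)
    (hR17 : Real.exp (-(a / 20)) ≤ c.eps2) (h231 : 2 * (4 : ℝ) * (M : ℝ) ^ 4 * Real.exp (-(a / 10)) ≤ a / 20)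
    (ha₂ : 0 ≤ a₂) (hκ229 : kappa₀ 64 8 + a₂ ≤ c.δ * c.κ)
    (hsm229 : c.α₆ * Real.exp a₂ * K₀ 64 8 * 64 ≤ a₂)
    (habsk : Real.exp (-(a / 20)) * 64 ≤ c.δ * c.κ)
    (h18half : B13Step237.R18half c (K₀ 64 8 * Real.exp (Real.exp (-(a / 20)) * 64)))
    (h18 : B13Step237.R18sharp c (K₀ 64 8 * Real.exp (Real.exp (-(a / 20)) * 64)) ((c.L : ℝ) / 2))
    (ha₂' : 0 ≤ a₂') (hκ229' : kappa₀ 64 8 + a₂' ≤ c.δ * ((c.L : ℝ) / 2) * c.κ)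
    (hsm229' : c.α₆ * Real.exp a₂' * K₀ 64 8 * 64 ≤ a₂')
    (hR20 : 18 * ((1 - 7 * c.δ) * ((c.L : ℝ) / 2) * c.κ) ≤ (c.κ₁ - 1) / 2)
    (ha₅ : 0 ≤ a₅) (habs : a₅ + Real.exp (-((c.κ₁ - 1) / 2)) ≤ Aabs)
    (hAc : Aabs * 64 ≤ c.δ * ((c.L : ℝ) / 2) * c.κ)
    (hC3 : B13Step237.bracketF c (K₀ 64 8 * Real.exp (Real.exp (-(a / 20)) * 64)) / c.α₆ *
      Real.exp (Aabs * 64) ≤ c.C3act * c.ε₁)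
    -- the two runs' activities are the end members of the pencil; (2.13) per run; space restriction
    {HA HB : TDom 4 N' → W.Φ → ℂ}
    (hHA : ∀ (Z : TDom 4 N') (φ : W.Φ), φ ∈ W.sp2 Z → HA Z φ = ∑ t ∈ terms L M Z,
      term214 r (lZ Z t) (lD t) (core214 (A Z t φ 0) (Γ Z t φ 0)
        (F214 t.2.card (χY₀ Z t φ) (χcP Z t φ) (Dfam Z t) (Vk Z t φ 0))) 0 0)
    (hHB : ∀ (Z : TDom 4 N') (φ : W.Φ), φ ∈ W.sp2 Z → HB Z φ = ∑ t ∈ terms L M Z,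
      term214 r (lZ Z t) (lD t) (core214 (A Z t φ 1) (Γ Z t φ 1)
        (F214 t.2.card (χY₀ Z t φ) (χcP Z t φ) (Dfam Z t) (Vk Z t φ 1))) 0 0)
    (hsp : ∀ X Z : TDom 4 N', ∀ φ, Z.1 ⊆ X.1 → φ ∈ W.sp2 X → φ ∈ W.sp2 Z)
    {EA EB : TDom 4 N' → W.Φ → ℂ}
    (h213A : ∀ (X : TDom 4 N') (φ : W.Φ), φ ∈ W.sp2 X →
      EA X φ = locE (TTouch (d := 4) (N := N')) (fun Z : TDom 4 N' => Z.1) (fun Z => HA Z φ) X.1)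
    (h213B : ∀ (X : TDom 4 N') (φ : W.Φ), φ ∈ W.sp2 X →
      EB X φ = locE (TTouch (d := 4) (N := N')) (fun Z : TDom 4 N' => Z.1) (fun Z => HB Z φ) X.1)
    (hAct : 0 ≤ c.C3act * c.ε₁) (hr₁ : 0 ≤ (1 - 10 * c.δ) * ((c.L : ℝ) / 2) * c.κ)
    (hlarge : (1 - 10 * c.δ) * ((c.L : ℝ) / 2) * c.κ + 2 * (64 * Real.log 162) + 2 ≤
      (1 - 8 * c.δ) * ((c.L : ℝ) / 2) * c.κ)
    (hsmall41 : c.C3act * c.ε₁ * Real.exp (5 * ((1 - 10 * c.δ) * ((c.L : ℝ) / 2) * c.κ) + 1) * K₀ 64 8 * 9 * 64 ≤ 1)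
    (hA₂ : Real.exp 1 * 9 * 64 * K₀ 64 8 ^ 2 ≤ c.A₂) :
    ∀ (X : TDom 4 N') (φ : W.Φ), φ ∈ W.sp2 X →
      ‖EB X φ - EA X φ‖ ≤
        2 * (c.A₂ * c.C3act * c.ε₁ *
          Real.exp (-((1 - 10 * c.δ) * ((c.L : ℝ) / 2) * c.κ * (tsys 4 N').dj X))) / ρ := by
  -- the pencil of (2.14)-term families read from the primitives
  let P : (Z : TDom 4 N') → Finset (TDom 4 (L * N')) × Finset (TBond 4 M (L * N')) → W.Φ → ℂ → ℂ :=
    fun Z t φ θ => term214 r (lZ Z t) (lD t) (core214 (A Z t φ θ) (Γ Z t φ θ)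
      (F214 t.2.card (χY₀ Z t φ) (χcP Z t φ) (Dfam Z t) (Vk Z t φ θ))) 0 0
  -- T21 per term and configuration
  have key : ∀ (Z : TDom 4 N') (φ : W.Φ), φ ∈ W.sp2 Z → ∀ t ∈ terms L M Z,
      DifferentiableOn ℂ (P Z t φ) (ball (0 : ℂ) ρ) ∧
        ∀ b ∈ ball (0 : ℂ) ρ, ‖P Z t φ b‖ ≤ weight L M c Z a t * Real.exp (a₅ * ((Z.1).card : ℝ)) := by
    intro Z φ hφ t ht
    exact hol_and_h226_torus_of_primitives_param c hκ₁ hα₆' Z t hpos hhalf hUσ hUτ hUexp hUtau hr hr' hsubτ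
      (lZ Z t) (hlZ Z t) (lD t) (hlD t) isOpen_ball (fun b => A Z t φ b) (fun b => Γ Z t φ b) (fun b => G Z t φ b)
      (χY₀ Z t φ) (χcP Z t φ) (hχ0 Z t φ) (hχc0 Z t φ) (Dfam Z t) (fun b => Vk Z t φ b) (hC Z t φ) (Γ₀ Z t φ)
      (hAhol Z t ht φ hφ) (hGhol Z t ht φ hφ) (hAholb Z t ht φ hφ) (hGholb Z t ht φ hφ) (hVholb Z t ht φ hφ)
      (hχm Z t φ) (hχcm Z t φ) (hVm Z t ht φ hφ) (hAs Z t ht φ hφ) (hA Z t ht φ hφ) (hlin Z t ht φ hφ)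
      (qP Z t φ) (h222 Z t φ) hγ₂ (hqP Z t φ) ha0 (h220U Z t ht φ hφ) (locΛ Z t) (locN Z t) (hfibΛ Z t)
      (hfibN Z t) hkap'' h1 h2 hθE hθΓ hθC hKG hKΓ hKCs hKC0 hθEle hθΓle hθR1le (hG Z t ht φ hφ) (hΓ₀ Z t ht φ hφ)
      (hCs Z t ht φ hφ) (hC216 Z t ht φ hφ) (hdΓ Z t ht φ hφ) (hdC Z t ht φ hφ) (hdE Z t ht φ hφ) hsmallKθ hc0
      (hc Z t φ) hαc hg (hΓq Z t ht φ hφ) hsmall hPa (hvol Z t ht)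
  exact norm_E_sub_le_torus c hL hLc W P hρ (fun Z φ hφ t ht => (key Z φ hφ t ht).1)
    (fun θ hθ Z φ hφ t ht => (key Z φ hφ t ht).2 θ hθ) hα₆ hε₀ hδ hδ7 hκ ha hR15 hR16 hR16' hR17 h231 ha₂ hκ229
    hsm229 habsk h18half h18 ha₂' hκ229' hsm229' hR20 ha₅ habs hAc hC3 hHA hHB hsp h213A h213B hAct hr₁ hlarge
    hsmall41 hA₂

end Summit.QuantumFields.BalabanUV.T4Continuum.Spine.NE5.TwoRunTorusPrimitivePencil

end
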